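import Literature.AlgebraicGeometry.Smoothening.SmoothSpecialFibre
import Mathlib.RingTheory.KrullDimension.Basic
import HarnessLib

/-!
# Points of codimension one in the special fibre of a smooth scheme over a discrete valuation ring

Topic: `Literature/AlgebraicGeometry/Smoothening` (Bosch–Lütkebohmert–Raynaud, *Néron Models*,
§2.3, §3.6 and Thm. 4.4/1; M. Artin, *Néron Models*, Prop. (1.3), Cor. (1.6): in Weil's extension
theorem one needs definedness at the points `y` of a smooth `R`-scheme with
`dim 𝒪_{X,y} ≤ 1`; those in the special fibre are the generic points of its components, and
their local rings are discrete valuation rings with uniformizer `ϖ`). Complements to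
`SmoothSpecialFibre` in the form met in practice, where the local ring is a stalk, i.e. an
abstract localisation `S` of `A = Γ(X, 𝒪)` at the prime `P` of the point:

* `mem_minimalPrimes_of_krullDimLE_one` — a non-zero prime `P ∋ f` of a domain `A` with
  `dim A_P ≤ 1` is a minimal prime of `fA`;
* `isDiscreteValuationRing_of_isLocalization_atPrime`,
  `irreducible_algebraMap_of_isLocalization_atPrime` — for `A` a smooth `R`-domain with
  `ϖ ≠ 0` and `P` a minimal prime of `ϖA`, every localisation `S` of `A` at `P` is a discrete
  valuation ring in which `ϖ` is a uniformizer (transport of `SmoothSpecialFibre` along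
  `Localization.AtPrime P ≃ S`).

[folklore]; no named facts (D-0026).

## References

* S. Bosch, W. Lütkebohmert, M. Raynaud, *Néron Models*, Springer 1990, §2.3, Thm. 4.4/1.
  [BLRNeronModels1990] (Not held; numbers only.)
* M. Artin, *Néron Models*, in Cornell–Silverman (eds.), *Arithmetic Geometry*, Springer 1986,
  Prop. (1.3), Cor. (1.6) (pp. 215–216). [Artin1986NeronModels]
-/

noncomputable section

open IsLocalRing

namespace Literature.AlgebraicGeometry.Smoothening

universe u

section Height

variable {A : Type u} [CommRing A] [IsDomain A] (P : Ideal A) [P.IsPrime]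
  (S : Type u) [CommRing S] [Algebra A S] [IsLocalization.AtPrime S P]

/-- **A non-zero prime `P ∋ f` with `dim A_P ≤ 1` is a minimal prime of `fA`** (`A` a domain):
a prime strictly between `(f)` and `P` would give a chain of length two in `A_P`. Stated for any
localisation `S` of `A` at `P`. [folklore] -/
theorem mem_minimalPrimes_of_krullDimLE_one [Ring.KrullDimLE 1 S] {f : A} (hfP : f ∈ P)
    (hf : f ≠ 0) : P ∈ (Ideal.span {f}).minimalPrimes := by
  haveI : IsDomain S :=
    IsLocalization.isDomain_of_le_nonZeroDivisors (M := P.primeCompl) S P.primeCompl_le_nonZeroDivisors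
  haveI := IsLocalization.AtPrime.isLocalRing S P
  refine ⟨⟨inferInstance, (Ideal.span_singleton_le_iff_mem _).mpr hfP⟩, fun Q ⟨hQ, hfQ⟩ hQP => ?_⟩
  -- `Q S` is a non-zero prime of the one-dimensional local domain `S`, hence maximal, hence `P S`
  have hdisj : Disjoint (P.primeCompl : Set A) (Q : Set A) :=
    Set.disjoint_left.mpr fun x hx hxQ => hx (hQP hxQ)
  have hQS : (Q.map (algebraMap A S)).IsPrime :=
    IsLocalization.isPrime_of_isPrime_disjoint P.primeCompl S Q hQ hdisj
  have hQS0 : Q.map (algebraMap A S) ≠ ⊥ := fun h0 => by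
    have hfS : algebraMap A S f ∈ Q.map (algebraMap A S) :=
      Ideal.mem_map_of_mem _ (hfQ (Ideal.mem_span_singleton_self f))
    rw [h0, Ideal.mem_bot] at hfS
    exact hf (IsLocalization.injective S P.primeCompl_le_nonZeroDivisors (by rw [hfS, map_zero]))
  have hmax : (Q.map (algebraMap A S)).IsMaximal :=
    (Ring.krullDimLE_one_iff_of_isPrime_bot.mp ‹_›) _ hQS0 hQS
  have heq : Q.map (algebraMap A S) = maximalIdeal S := IsLocalRing.eq_maximalIdeal hmax
  -- pull back to `A`
  intro x hxP
  have hxS : algebraMap A S x ∈ Q.map (algebraMap A S) := by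
    rw [heq]
    exact (IsLocalization.AtPrime.to_map_mem_maximal_iff S P x).mpr hxP
  have hx' : x ∈ (Q.map (algebraMap A S)).under A := Ideal.mem_comap.mpr hxS
  rwa [IsLocalization.under_map_of_isPrime_disjoint P.primeCompl S hQ hdisj] at hx'

end Height

section DVR

variable {R : Type u} [CommRing R] [IsDomain R] [IsDiscreteValuationRing R] {ϖ : R} (hϖ : Irreducible ϖ)
  {A : Type u} [CommRing A] [Algebra R A] [Algebra.Smooth R A] [IsDomain A]
  (P : Ideal A) [P.IsPrime] (hP : P ∈ (Ideal.span {algebraMap R A ϖ}).minimalPrimes)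
  (S : Type u) [CommRing S] [IsDomain S] [Algebra A S] [Algebra R S] [IsScalarTower R A S]
  [IsLocalization.AtPrime S P]

omit [Algebra R S] [IsScalarTower R A S] in
include hϖ hP in
/-- **Every localisation of a smooth `R`-domain at a minimal prime of `ϖA` is a discrete valuation
ring** (transport of `isDiscreteValuationRing_localization`). [folklore] -/
theorem isDiscreteValuationRing_of_isLocalization_atPrime (hϖA : algebraMap R A ϖ ≠ 0) :
    IsDiscreteValuationRing S := by
  haveI := isDiscreteValuationRing_localization hϖ P hP hϖA
  exact IsDiscreteValuationRing.RingEquivClass.isDiscreteValuationRing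
    (IsLocalization.algEquiv P.primeCompl (Localization.AtPrime P) S).toRingEquiv

omit [IsDomain S] in
include hϖ hP in
/-- **… in which `ϖ` is a uniformizer** (transport of `irreducible_algebraMap_localization`).
[folklore] -/
theorem irreducible_algebraMap_of_isLocalization_atPrime (hϖA : algebraMap R A ϖ ≠ 0) :
    Irreducible (algebraMap R S ϖ) := by
  have h := irreducible_algebraMap_localization hϖ P hP hϖA
  let e := (IsLocalization.algEquiv P.primeCompl (Localization.AtPrime P) S).toMulEquiv
  have he : e (algebraMap R (Localization.AtPrime P) ϖ) = algebraMap R S ϖ := by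
    change IsLocalization.algEquiv P.primeCompl (Localization.AtPrime P) S
      (algebraMap R (Localization.AtPrime P) ϖ) = _
    rw [IsScalarTower.algebraMap_apply R A (Localization.AtPrime P), AlgEquiv.commutes,
      ← IsScalarTower.algebraMap_apply]
  rw [← he]
  exact (MulEquiv.irreducible_iff e).mpr h

end DVR

end Literature.AlgebraicGeometry.Smoothening

end
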